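import Mathlib
import Literature.AlgebraicGeometry.Resolution.PointBlowupFlagInvariant
import Literature.AlgebraicGeometry.Resolution.PointBlowupHeightVectorDrops
import Literature.AlgebraicGeometry.Resolution.PointBlowupFlagShiftBound
import Literature.AlgebraicGeometry.Resolution.ShearedBinaryFormOrder
import Summits.ResolutionOfSingularities.ResolutionOfSingularities.Theorems.WeightedInvariantLocalWeightedDropInsepCleaning
import Summits.ResolutionOfSingularities.ResolutionOfSingularities.Theorems.WeightedInvariantLocalWeightedDropInsepNewtonMeasures
import Summits.ResolutionOfSingularities.ResolutionOfSingularities.Theorems.WeightedInvariantLocalWeightedDropInsepNewtonVMove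
import Summits.ResolutionOfSingularities.ResolutionOfSingularities.Theorems.WeightedInvariantLocalWeightedDropInsepNewtonVHeight
import Summits.ResolutionOfSingularities.ResolutionOfSingularities.Theorems.WeightedInvariantLocalWeightedDropInsepNewtonHMove
import Summits.ResolutionOfSingularities.ResolutionOfSingularities.Theorems.WeightedInvariantLocalWeightedDropInsepNewtonClean
import Summits.ResolutionOfSingularities.ResolutionOfSingularities.Theorems.WeightedInvariantLocalWeightedDropInsepNewtonShear
import Summits.ResolutionOfSingularities.ResolutionOfSingularities.Theorems.WeightedInvariantLocalWeightedDropInsepNewtonTMove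

/-!
# `WeightedInvariant.LocalWeightedDrop`, line `hasse-ridge-face-selection`: the lift's point-blow-up CHARTS through the shear
# (`π_{1,c} = π_H(c₁) ∘ θ_{(c₀/c₁)z}`), cleaning bookkeeping, and the bonus arithmetic of [HW14] Prop. 1 / Prop. 2 (unit M4/M5)

Crux item stmt-ResolutionOfSingularities-8899 `LocalWeightedDrop` (route `ResolutionOfSingularities/WeightedInvariant`),
serving the door `WeightedConstruction` stmt-ResolutionOfSingularities-0571.  [OURS · L1 W4.3, chain w43, stub worker 3
(gen 3): units M4/M5 of L/res-L1-w43-stub-3/S2iM-ATTACK-PLAN.md (key S2iM `stub_charTwoInseparableReductionWon`, closing form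
`charTwoInseparableReductionWon_of_insepStateRank`, p485441); the mathematics is Hauser–Wagner 2014 §6.1 (Rem. 10: a translational
point is «a linear coordinate change followed by move (H)»; Prop. 2's case arithmetic with `0 < ε < δ < 1`); NOT a statement of any
manuscript.]

* `subst_pointChart_one_eq`: the lift's chart `π_{1,c} : x₁ ↦ c₁X₀, x₀ ↦ X₀(c₀ + X₁)` (`c₁ ≠ 0`) IS `π_H(c₁) ∘ θ_{(c₀/c₁)·z}`;
* `cleanSeries_subst_piH_of_clean` / `…_piV_of_clean` / `cleanSeries_X_sq_mul` / `cleanSeries_two_subst_cleanSeries`: cleaning commutes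
  with the charts; hence `piH_cleanShear_eq`: from the lift's RAW datum `π_{1,c}^* A = X₀² A′` one gets
  `π_H(c₁)^* clean₂(θ^* clean₂ A) = X₀² · clean₂ A′` — every measure lemma of `…InsepNewtonHMove` / `…InsepNewtonSlope` /
  `…InsepNewtonTMove` applies to the pair `(clean₂(θ^* clean₂ A), clean₂ A′)`; `piV_clean_eq` the same at the flag point (move (V));
* `four_mul_add_bonus_lt_of_forced` (**Prop. 2**: free order drops, `h′ + o′ ≤ h + parity` ⇒ `4h′ − b(o′) < 4h − b(o)` with
  `b = (6, 1, 0, 0, …) = 4·(1+δ, ε, 0, …)`, `ε = 1/4`, `δ = 1/2`), `four_mul_add_bonus_lt_of_vertical` (**Prop. 1, move (V)**),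
  `four_mul_add_bonus_le_of_horizontal` (move (H): the slope decides).
NOT here: the chart `i₀ = 0` at a point with `c₁ ≠ 0` (the other affine presentation of a (T)-point; it differs from `π_{1,c}` by
`X₀ ↦ X₀·u(X₁)`, `X₁ ↦ X₁·v(X₁)` — to be removed by a chart-SELECTING variant of the lift, see stub-3's M6 design memo).
-/

set_option linter.dupNamespace false -- mandated namespace of this single-conjunct summit

namespace Summit.ResolutionOfSingularities.ResolutionOfSingularities.Theorems

namespace InsepNewton

open MvPowerSeries
open Literature.AlgebraicGeometry.Resolution
open Literature.AlgebraicGeometry.Resolution.HauserPerlega2024 (ordAlong cleanSeries)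
open Literature.AlgebraicGeometry.Resolution.HauserWagner2014 (ordVarPS degAlongPS heightPS)

variable {K : Type} [Field K]

/-! ### The lift's charts through the shear: `π_{1,c} = π_H(c₁) ∘ θ_{(c₀/c₁)z}`, cleaning commutes -/

/-- The linear shear `φ = a·z` as a power series: zero constant term. -/
theorem constantCoeff_C_mul_X (a : K) : PowerSeries.constantCoeff (PowerSeries.C a * PowerSeries.X) = 0 := by
  rw [map_mul, PowerSeries.constantCoeff_X, mul_zero]

/-- … and linear part `a`. -/
theorem coeff_one_C_mul_X (a : K) : PowerSeries.coeff 1 (PowerSeries.C a * PowerSeries.X) = a := by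
  rw [PowerSeries.coeff_C_mul, PowerSeries.coeff_one_X, mul_one]

/-- Substituting `z = X₁` into `a·z`. -/
theorem subst_X_one_C_mul_X (a : K) :
    PowerSeries.subst (X 1 : MvPowerSeries (Fin 2) K) (PowerSeries.C a * PowerSeries.X) = C a * X 1 := by
  rw [PowerSeries.subst_mul (PowerSeries.HasSubst.X 1), PowerSeries.subst_C, PowerSeries.subst_X (PowerSeries.HasSubst.X 1)]

/-- **THE (T)-CHART IS «SHEAR, THEN (H)-CHART»**: the lift's chart `π_{1,c} : x₁ ↦ c₁X₀, x₀ ↦ X₀(c₀ + X₁)` at a point `c` with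
`c₁ ≠ 0` equals `π_H(c₁) ∘ θ_{(c₀/c₁)·z}` — `x₀ + (c₀/c₁)x₁ ↦ X₀X₁ + c₀X₀`. [cite: HauserWagner2014, §6.1 Rem. 10 p. 201 ("a linear coordinate change … followed by move (H)")] -/
theorem subst_pointChart_one_eq (c : Fin 2 → K) (hc : c 1 ≠ 0) (A : MvPowerSeries (Fin 2) K) :
    subst (fun l : Fin 2 => if l = 1 then C (c 1) * X 0 else X 0 * (C (c l) + (X 1 : MvPowerSeries (Fin 2) K))) A =
      subst (fun l : Fin 2 => if l = 1 then C (c 1) * X 0 else (X 0 * X 1 : MvPowerSeries (Fin 2) K))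
        (subst (fun l : Fin 2 => if l = 0 then (X 0 : MvPowerSeries (Fin 2) K) +
          PowerSeries.subst (X 1 : MvPowerSeries (Fin 2) K) (PowerSeries.C (c 0 * (c 1)⁻¹) * PowerSeries.X) else X l) A) := by
  have hθ := hasSubst_shear (K := K) (constantCoeff_C_mul_X (c 0 * (c 1)⁻¹))
  have hH := hasSubst_piH (K := K) (c 1)
  rw [subst_comp_subst_apply hθ hH]
  congr 1
  funext l
  rcases (by fin_cases l <;> simp : l = 0 ∨ l = 1) with rfl | rfl
  · rw [if_neg (show (0 : Fin 2) ≠ 1 by decide), if_pos rfl, subst_X_one_C_mul_X, subst_add hH, subst_mul hH, subst_C]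
    simp only [subst_X hH, Fin.isValue, if_true, if_false, zero_ne_one]
    rw [← mul_assoc, ← map_mul, show c 0 * (c 1)⁻¹ * c 1 = c 0 by rw [mul_assoc, inv_mul_cancel₀ hc, mul_one]]
    ring
  · rw [if_pos rfl, if_neg (show (1 : Fin 2) ≠ 0 by decide)]
    simp only [subst_X hH, Fin.isValue, if_true]

/-- Cleaning commutes with the monomial `X₀²`: `clean₂(X₀² · B) = X₀² · clean₂(B)`. -/
theorem cleanSeries_X_sq_mul (B : MvPowerSeries (Fin 2) K) : cleanSeries 2 (X 0 ^ 2 * B) = X 0 ^ 2 * cleanSeries 2 B := by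
  classical
  ext e
  rw [InsepCleaning.coeff_cleanSeries, coeff_X_pow_mul', coeff_X_pow_mul']
  by_cases hle : 2 ≤ e 0
  · rw [if_pos hle, if_pos hle, InsepCleaning.coeff_cleanSeries]
    have hiff : (∀ i : Fin 2, 2 ∣ e i) ↔ ∀ i : Fin 2, 2 ∣ (e - Finsupp.single 0 2 : Fin 2 →₀ ℕ) i := by
      constructor
      · intro h i
        rw [Finsupp.tsub_apply]
        rcases (by fin_cases i <;> simp : i = 0 ∨ i = 1) with rfl | rfl
        · rw [Finsupp.single_eq_same]; obtain ⟨m, hm⟩ := h 0; exact ⟨m - 1, by omega⟩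
        · rw [Finsupp.single_eq_of_ne (one_ne_zero), tsub_zero]; exact h 1
      · intro h i
        have hi := h i
        rw [Finsupp.tsub_apply] at hi
        rcases (by fin_cases i <;> simp : i = 0 ∨ i = 1) with rfl | rfl
        · rw [Finsupp.single_eq_same] at hi; obtain ⟨m, hm⟩ := hi; exact ⟨m + 1, by omega⟩
        · rwa [Finsupp.single_eq_of_ne (one_ne_zero), tsub_zero] at hi
    by_cases hall : ∀ i : Fin 2, 2 ∣ e i
    · rw [if_pos hall, if_pos (hiff.mp hall)]
    · rw [if_neg hall, if_neg (fun h => hall (hiff.mpr h))]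
  · rw [if_neg hle, if_neg hle]
    split_ifs <;> rfl

/-- The horizontal chart of a CLEAN series is clean (`π_H` maps `x₀^α x₁^β ↦ c₁^β X₀^{α+β} X₁^α`, parities preserved). -/
theorem cleanSeries_subst_piH_of_clean (c₁ : K) {B : MvPowerSeries (Fin 2) K} (hB : cleanSeries 2 B = B) :
    cleanSeries 2 (subst (fun l : Fin 2 => if l = 1 then C c₁ * X 0 else (X 0 * X 1 : MvPowerSeries (Fin 2) K)) B) =
      subst (fun l : Fin 2 => if l = 1 then C c₁ * X 0 else (X 0 * X 1 : MvPowerSeries (Fin 2) K)) B := by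
  classical
  rw [isClean_iff] at hB ⊢
  intro e he
  rw [coeff_subst_piH]
  split_ifs with hle
  · rw [hB _ ((forall_two_dvd_pair_iff _ _).mpr ⟨he 1, ?_⟩), mul_zero]
    obtain ⟨m, hm⟩ := he 0
    obtain ⟨n, hn⟩ := he 1
    exact ⟨m - n, by omega⟩
  · rfl

/-- The vertical chart of a CLEAN series is clean (`π_V` maps `x₀^α x₁^β ↦ c₀^α X₀^{α+β} X₁^β`). -/
theorem cleanSeries_subst_piV_of_clean (c₀ : K) {B : MvPowerSeries (Fin 2) K} (hB : cleanSeries 2 B = B) :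
    cleanSeries 2 (subst (fun l : Fin 2 => if l = 0 then C c₀ * X 0 else (X 0 * X 1 : MvPowerSeries (Fin 2) K)) B) =
      subst (fun l : Fin 2 => if l = 0 then C c₀ * X 0 else (X 0 * X 1 : MvPowerSeries (Fin 2) K)) B := by
  classical
  rw [isClean_iff] at hB ⊢
  intro e he
  rw [coeff_subst_piV]
  split_ifs with hle
  · rw [hB _ ((forall_two_dvd_pair_iff _ _).mpr ⟨?_, he 1⟩), mul_zero]
    obtain ⟨m, hm⟩ := he 0
    obtain ⟨n, hn⟩ := he 1
    exact ⟨m - n, by omega⟩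
  · rfl

/-- `X₀²` is cancellable. -/
theorem X_sq_mul_cancel {B B' : MvPowerSeries (Fin 2) K} (h : (X 0 : MvPowerSeries (Fin 2) K) ^ 2 * B = X 0 ^ 2 * B') : B = B' :=
  mul_left_cancel₀ (pow_ne_zero 2 (X_ne_zero'' 0)) h

section CharTwoCharts

variable [CharP K 2]

/-- Cleaning at `2 = 2¹` commutes with any substitution (res-lit-5's `cleanSeries_subst_cleanSeries` at `p = 2`, `e = 1`). -/
theorem cleanSeries_two_subst_cleanSeries {τ : Type} {a : Fin 2 → MvPowerSeries τ K} (ha : HasSubst a) (S : MvPowerSeries (Fin 2) K) :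
    cleanSeries 2 (subst a (cleanSeries 2 S)) = cleanSeries 2 (subst a S) := by
  haveI : Fact (2 : ℕ).Prime := ⟨Nat.prime_two⟩
  have h := HauserPerlega2024.cleanSeries_subst_cleanSeries (K := K) 2 1 ha S
  rwa [pow_one] at h

/-- **THE CLEANED (T)/(H)-SUCCESSOR OF A RAW POSITION IS THE (H)-SUCCESSOR OF THE CLEANED SHEAR OF ITS CLEANING**: if the lift hands
`π_{1,c}^* A = X₀² A′` (`c₁ ≠ 0`; `c₀ = 0` is the (H)-point), then with `φ = (c₀/c₁)·z` and `G = clean₂(θ_φ^* clean₂ A)` one has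
`π_H(c₁)^* G = X₀² · clean₂ A′` — so every measure lemma of this file and of `…InsepNewtonHMove` / `…InsepNewtonSlope` applies to the pair
`(G, clean₂ A′)`. -/
theorem piH_cleanShear_eq (c : Fin 2 → K) (hc : c 1 ≠ 0) {A A' : MvPowerSeries (Fin 2) K}
    (hfac : subst (fun l : Fin 2 => if l = 1 then C (c 1) * X 0 else X 0 * (C (c l) + (X 1 : MvPowerSeries (Fin 2) K))) A =
      X 0 ^ 2 * A') :
    subst (fun l : Fin 2 => if l = 1 then C (c 1) * X 0 else (X 0 * X 1 : MvPowerSeries (Fin 2) K))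
      (cleanSeries 2 (subst (fun l : Fin 2 => if l = 0 then (X 0 : MvPowerSeries (Fin 2) K) +
          PowerSeries.subst (X 1 : MvPowerSeries (Fin 2) K) (PowerSeries.C (c 0 * (c 1)⁻¹) * PowerSeries.X) else X l)
        (cleanSeries 2 A))) = X 0 ^ 2 * cleanSeries 2 A' := by
  have hθ := hasSubst_shear (K := K) (constantCoeff_C_mul_X (c 0 * (c 1)⁻¹))
  have hH := hasSubst_piH (K := K) (c 1)
  rw [cleanSeries_two_subst_cleanSeries hθ, ← cleanSeries_subst_piH_of_clean (c 1) (InsepCleaning.cleanSeries_cleanSeries 2 _),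
    cleanSeries_two_subst_cleanSeries hH, ← subst_pointChart_one_eq c hc, hfac, cleanSeries_X_sq_mul]

/-- The same bookkeeping AT THE FLAG POINT (`i₀ = 0`, `c₁ = 0`, the (V)-move): `π_V(c₀)^* (clean₂ A) = X₀² · clean₂ A′`. -/
theorem piV_clean_eq (c₀ : K) {A A' : MvPowerSeries (Fin 2) K}
    (hfac : subst (fun l : Fin 2 => if l = 0 then C c₀ * X 0 else (X 0 * X 1 : MvPowerSeries (Fin 2) K)) A = X 0 ^ 2 * A') :
    subst (fun l : Fin 2 => if l = 0 then C c₀ * X 0 else (X 0 * X 1 : MvPowerSeries (Fin 2) K)) (cleanSeries 2 A) =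
      X 0 ^ 2 * cleanSeries 2 A' := by
  have hV := hasSubst_piV (K := K) c₀
  rw [← cleanSeries_subst_piV_of_clean c₀ (InsepCleaning.cleanSeries_cleanSeries 2 _), cleanSeries_two_subst_cleanSeries hV, hfac,
    cleanSeries_X_sq_mul]

end CharTwoCharts

/-! ### [HW14] Prop. 2: the bonus arithmetic (scaled by 4: `ε = 1/4`, `δ = 1/2`, `intricacy = height − bonus`) -/

/-- **PROP. 2'S ARITHMETIC, FORCED (T)**: with the bonus `b(0) = 6 = 4(1+δ)`, `b(1) = 1 = 4ε`, `b(≥2) = 0`: if the free order DROPS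
(`o′ < o`) and `h′ + o′ ≤ h + parity`, `parity ≤ 1`, then `4h′ − b(o′) < 4h − b(o)`, written without subtraction.  (The four transitions
distant → distant / close / adjacent and close → adjacent of the printed proof; `ε < δ` is what the case close → adjacent with parity `1` —
the kangaroo — needs.) [cite: HauserWagner2014, §6.1 Prop. 2 p. 204] -/
theorem four_mul_add_bonus_lt_of_forced {h h' o o' par : ℕ} (hpar : par ≤ 1) (ho : o' < o) (hh : h' + o' ≤ h + par) :
    4 * h' + (if o = 0 then 6 else if o = 1 then 1 else 0) < 4 * h + (if o' = 0 then 6 else if o' = 1 then 1 else 0) := by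
  have ho0 : o ≠ 0 := by omega
  rw [if_neg ho0]
  by_cases ho1 : o = 1
  · subst ho1
    have : o' = 0 := by omega
    subst this
    simp only [↓reduceIte]
    omega
  · rw [if_neg ho1, add_zero]
    split_ifs <;> omega

/-- **PROP. 1'S ARITHMETIC, MOVE (V)**: `h′ + 1 ≤ h`, the successor is NOT adjacent (`o′ ≥ 1`), and from an adjacent position the height
drops by `2` (the non-quasi-monomial, non-monomial case): then `4h′ − b(o′) < 4h − b(o)`. [cite: HauserWagner2014, §6.1 (V) p. 205] -/
theorem four_mul_add_bonus_lt_of_vertical {h h' o o' : ℕ} (hh : h' + 1 ≤ h) (ho' : o' ≠ 0) (hadj : o = 0 → h' + 2 ≤ h) :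
    4 * h' + (if o = 0 then 6 else if o = 1 then 1 else 0) < 4 * h + (if o' = 0 then 6 else if o' = 1 then 1 else 0) := by
  rw [if_neg ho']
  by_cases ho : o = 0
  · have := hadj ho
    rw [if_pos ho]
    split_ifs <;> omega
  · rw [if_neg ho]
    split_ifs <;> omega

/-- **(H) / NON-FORCED (T) ARITHMETIC**: equal free order and `h′ ≤ h` give `4h′ − b(o) ≤ 4h − b(o)` (the slope then decides,
`…InsepNewtonSlope.slopePS_hSucc_lt`). [cite: HauserWagner2014, §6.1 (H) p. 204] -/
theorem four_mul_add_bonus_le_of_horizontal {h h' o : ℕ} (hh : h' ≤ h) :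
    4 * h' + (if o = 0 then 6 else if o = 1 then 1 else 0) ≤ 4 * h + (if o = 0 then 6 else if o = 1 then 1 else 0) := by
  omega

end InsepNewton

end Summit.ResolutionOfSingularities.ResolutionOfSingularities.Theorems
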